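import Mathlib.Geometry.Manifold.SmoothEmbedding
import Mathlib.Geometry.Manifold.Instances.Real
import Mathlib.Geometry.Manifold.Diffeomorph
import Mathlib.Geometry.Manifold.IsManifold.InteriorBoundary
import Literature.Topology.FourManifolds.Morse
import Literature.Topology.FourManifolds.Cobordism
import HarnessLib

-- provenance: harness21/H21/H21/Prelude/FourManL/Handles.lean @ 652391f (interim HEAD d8f2665); M5 mechanical rewrite
/-!
# Handles, elementary cobordisms and handlebodies (trunk FourManL, notion
`kirby_calculus_handles`, layer (a))

This file phrases the handle calculus of compact smooth manifolds with boundary through Morse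
functions (outline `H21/Outlines/FourManL.md`, §C4):

* `Literature.Cobordism.IsMorseFunction c f`: a Morse function on a cobordism `(W; M, N)` in the sense
  of Milnor (1965), Def. 2.3: `f` is Morse, `f⁻¹ 0 = M`, `f⁻¹ 1 = N`, no critical points on `∂W`.
* `Literature.Cobordism.IsElementary c k`: `c` is an *elementary cobordism of index `k`*, i.e. it carries
  a Morse function with exactly one critical point, of index `k` (Milnor 1965, Def. 3.10); this is
  the trace of attaching a single `k`-handle / of a `(k-1)`-surgery (Milnor 1965, Thm. 3.13).
* `Literature.IsHandleAttachment n k W W'`: "`W' ≅ W ∪ hᵏ`", `W'` is obtained from `W` by attaching one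
  `k`-handle (Milnor 1963, Thm. 3.2; Kosinski, *Differential Manifolds*, VI.6–7).
* `Literature.IsHandlebodyOfIndexLE n k W`: `W` is a handlebody with handles of index `≤ k` only.
* `Literature.HasHandleDecomposition n W c`: `W` has a handle decomposition with `c k` handles of index
  `k`.

`IsHandleAttachment`, `IsHandlebodyOfIndexLE` and `HasHandleDecomposition` are PREDICATES (definitions
with explicit binders `n k W …`).  `IsHandlebodyOfIndexLE` and `HasHandleDecomposition` are inhabited
non-trivially by the closed ball `𝔻ⁿ⁺¹` (`ClosedBallHandles.lean`) and by Mathlib's interval `[x, y]`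
(`HandlebodyInterval.lean`); witnesses of `IsHandleAttachment` are the regular-level slabs of
`SPC4HandleChainProofs.lean` (`isHandleAttachment_iter`, dimension `≥ 2`; in dimension `1` a second
attachment `W₁ ↪ W₂` on a nonempty compact `W₁` is impossible,
`IsHandleAttachment.false_of_dim_one`).  The named facts of this file (closed `Prop`s awaiting
discharge) are `Cobordism.exists_isMorseFunction`, `Cobordism.isTrivial_of_isMorseFunction`,
`Cobordism.IsElementary.symm`, `HasHandleDecomposition.isHandlebodyOfIndexLE` (discharged in
`HandlesProofs.lean`) and `exists_hasHandleDecomposition`.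

The file also states Milnor's product theorem (`Cobordism.isTrivial_of_isMorseFunction`, Milnor
1965, Thm. 3.4) and duality of elementary cobordisms (`Cobordism.IsElementary.symm`).

## Why Morse functions

Classically `W ∪_φ Dᵏ × Dⁿ⁺¹⁻ᵏ` is a topological manifold whose smooth structure requires
*straightening the corner* along `∂Dᵏ × ∂Dⁿ⁺¹⁻ᵏ` (Kosinski VI.6; Milnor 1965, §3); neither gluing
of smooth manifolds along boundary pieces nor corner smoothing is available in Mathlib.  Milnor
(1963, Thm. 3.2 "passing a nondegenerate critical point of index `k` attaches a `k`-handle";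
1965, Thm. 3.13) shows that, up to diffeomorphism, attaching a `k`-handle to `W` is the same as
passing to a larger sublevel set of a Morse function across a single critical point of index `k`.
We take this characterisation as the definition: `IsHandleAttachment n k W W'` holds iff `W`
embeds into `W'` as the sublevel set `f⁻¹ (-∞, a]` at a regular value `a` of a Morse function `f`
adapted to `∂W'` whose only critical point above level `a` has index `k`.  Up to diffeomorphism
(relative to `W`) this is the classical `W ∪_φ Dᵏ × Dⁿ⁺¹⁻ᵏ`.

## Mathlib status

Mathlib (pinned commit) has no handles, handlebodies or elementary cobordisms (grep for
`handlebody`, `elementary cobordism` is empty).  We use `Manifold.IsSmoothEmbedding`,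
`ModelWithCorners.boundary/interior`, the model `𝓡∂ (n + 1)` and the accepted H21 files
`Prelude/FourManL/Morse.lean` (`IsMorse`, `IsMCriticalPt`, `morseIndex`, `IsMorseAdapted`,
`criticalSetOfIndex`, `IsMorse.finite_criticalSet`) and `Prelude/FourManM/Cobordism.lean`
(`Cobordism n M N`, `Cobordism.symm`, `Cobordism.IsTrivial`).

## References

* J. Milnor, *Morse theory*, Ann. of Math. Studies 51 (1963), §3 (Thm. 3.1, 3.2).
* J. Milnor, *Lectures on the h-cobordism theorem*, Princeton (1965), §2 (Def. 2.3, Thm. 2.5),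
  §3 (Thm. 3.4, Def. 3.10, Thms. 3.12–3.13). [MilnorHCobordism1965]
* Y. Matsumoto, *An introduction to Morse theory*, AMS (2001), Def. 3.3, Thm. 3.4. [Matsumoto2001]
* A. Kosinski, *Differential Manifolds*, Academic Press (1993), Ch. VI–VII.
* S. Smale, *On the structure of manifolds*, Amer. J. Math. 84 (1962).
-/

open scoped Manifold ContDiff Topology
open Set Function

noncomputable section

namespace Literature.Topology.FourManifolds

universe u

/-- Local notation: `𝔼 n` is the model Euclidean space `EuclideanSpace ℝ (Fin n)`. -/
local notation "𝔼 " n:arg => EuclideanSpace ℝ (Fin n)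

/-! ### Morse functions on cobordisms; elementary cobordisms -/

namespace Cobordism

variable {n : ℕ} {M N : Type u} [TopologicalSpace M] [ChartedSpace (𝔼 n) M]
  [TopologicalSpace N] [ChartedSpace (𝔼 n) N]

/-- A *Morse function on the cobordism* `c = (W; M, N)`: a Morse function `f : W → ℝ` (for the
model with boundary `𝓡∂ (n + 1)`) with `f = 0` on the incoming boundary `M`, `f = 1` on the
outgoing boundary `N`, no critical points on `∂W`, and values in `(0, 1)` on the interior (so
that `f⁻¹ 0 = M`, `f⁻¹ 1 = N`).  Milnor, *Lectures on the h-cobordism theorem* (1965), Def. 2.3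
(Morse function on a triad `(W; V₀, V₁)`, with `[a, b] = [0, 1]`; Def. 3.1 there is the notion of
gradient-like vector field). [cite: MilnorHCobordism1965, Def. 2.3] -/
def IsMorseFunction (c : Cobordism n M N) (f : c.W → ℝ) : Prop :=
  IsMorse (𝓡∂ (n + 1)) f ∧ (∀ x, f (c.inl x) = 0) ∧ (∀ y, f (c.inr y) = 1) ∧
    (∀ z ∈ (𝓡∂ (n + 1)).boundary c.W, ¬ IsMCriticalPt (𝓡∂ (n + 1)) f z) ∧
    ∀ z ∈ (𝓡∂ (n + 1)).interior c.W, f z ∈ Ioo 0 1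

/-- A Morse function on a cobordism is a Morse function (Milnor 1965, Def. 2.3). [cite: MilnorHCobordism1965, Def. 2.3] -/
theorem IsMorseFunction.isMorse {c : Cobordism n M N} {f : c.W → ℝ} (hf : c.IsMorseFunction f) :
    IsMorse (𝓡∂ (n + 1)) f :=
  hf.1

/-- A Morse function on a cobordism takes values in `[0, 1]` (Milnor 1965, Def. 2.3). [cite: MilnorHCobordism1965, Def. 2.3] -/
theorem IsMorseFunction.mem_Icc {c : Cobordism n M N} {f : c.W → ℝ} (hf : c.IsMorseFunction f)
    (z : c.W) : f z ∈ Icc 0 1 := by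
  by_cases hz : z ∈ (𝓡∂ (n + 1)).interior c.W
  · exact Ioo_subset_Icc_self (hf.2.2.2.2 z hz)
  · have hb : z ∈ (𝓡∂ (n + 1)).boundary c.W := by
      rw [← ModelWithCorners.compl_interior]; exact hz
    rw [← c.range_inl_union_range_inr] at hb
    rcases hb with ⟨x, rfl⟩ | ⟨y, rfl⟩
    · rw [hf.2.1 x]; exact ⟨le_rfl, zero_le_one⟩
    · rw [hf.2.2.1 y]; exact ⟨zero_le_one, le_rfl⟩

/-- Every cobordism admits a Morse function (Milnor 1965, Thm. 2.5 with Def. 2.3).  Named fact: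
existence of Morse functions (density/genericity) is absent from Mathlib. [cite: MilnorHCobordism1965, Thm. 2.5] -/
def exists_isMorseFunction : Prop :=
  ∀ (c : Cobordism n M N),
    ∃ f, c.IsMorseFunction f

/-- `c` is an *elementary cobordism of index `k`*: it carries a Morse function (in the sense of
`Cobordism.IsMorseFunction`) with exactly one critical point, and that critical point has Morse
index `k`.  Equivalently `W` is the trace of attaching one `k`-handle to `M × [0, 1]`, or of a
surgery of type `(k, n + 1 - k)` on `M`.  Milnor, *Lectures on the h-cobordism theorem* (1965),
Def. 3.10 (elementary cobordism: a Morse function with exactly one critical point; its index is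
well defined by Thm. 3.15 and the Remark after Def. 3.10) and Thms. 3.12–3.13.
[cite: MilnorHCobordism1965, Def. 3.10] -/
def IsElementary (c : Cobordism n M N) (k : ℕ) : Prop :=
  ∃ f, c.IsMorseFunction f ∧ (∃! z, IsMCriticalPt (𝓡∂ (n + 1)) f z) ∧
    ∀ z, IsMCriticalPt (𝓡∂ (n + 1)) f z → morseIndex (𝓡∂ (n + 1)) f z = k

/-- The index of an elementary cobordism is at most `n + 1 = dim W`
(Milnor 1965, §3; `morseIndex_le_finrank`). [cite: MilnorHCobordism1965, §3] -/
theorem IsElementary.le {c : Cobordism n M N} {k : ℕ} (h : c.IsElementary k) : k ≤ n + 1 := by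
  obtain ⟨f, -, ⟨z, hz, -⟩, hk⟩ := h
  rw [← hk z hz]
  simpa using morseIndex_le_finrank (𝓡∂ (n + 1)) f z

/-- **Milnor's product theorem.**  If a cobordism `(W; M, N)` between closed smooth manifolds
carries a Morse function without critical points, then it is a product cobordism:
`W ≅ M × [0, 1]` relative to `M` (flow of a gradient-like vector field).  Milnor, *Lectures on
the h-cobordism theorem* (1965), Thm. 3.4; Milnor, *Morse theory* (1963), Thm. 3.1. [cite: MilnorHCobordism1965, Thm. 3.4] -/
def isTrivial_of_isMorseFunction : Prop :=
  ∀ [T2Space M] [SecondCountableTopology M] [IsManifold (𝓡 n) ∞ M] [CompactSpace M] {c : Cobordism n M N} {f : c.W → ℝ} (hf : c.IsMorseFunction f) (h : ∀ z, ¬ IsMCriticalPt (𝓡∂ (n + 1)) f z),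
    c.IsTrivial

/-- **Duality of elementary cobordisms.**  Turning an elementary cobordism of index `k` upside
down (replacing `f` by `1 - f`, which swaps the roles of `M` and `N` and replaces the Morse index
`k` of the nondegenerate critical point by `(n + 1) - k`) gives an elementary cobordism of index
`n + 1 - k` from `N` to `M`.  Milnor, *Lectures on the h-cobordism theorem* (1965), §3–4 (dual
handle decomposition, proof of Thm. 4.8); Kosinski VI.10.  Named fact: needs
`morseIndex (1 - f) z = finrank - morseIndex f z` at a nondegenerate critical point. [cite: MilnorHCobordism1965, §3–4 (dual decomposition, proof of Thm. 4.8)] -/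
def IsElementary.symm : Prop :=
  ∀ {c : Cobordism n M N} {k l : ℕ} (hkl : k + l = n + 1) (h : c.IsElementary k),
    c.symm.IsElementary l

end Cobordism

/-! ### Handle attachments and handlebodies -/

section Handles

/-- `W'` is obtained from `W` by *attaching a `k`-handle*, "`W' ≅ W ∪_φ Dᵏ × Dⁿ⁺¹⁻ᵏ`", phrased
through Morse theory: there are a smooth embedding `ι : W → W'`, a Morse function `f : W' → ℝ`
adapted to `∂W'` (`IsMorseAdapted`: `f ≡ 1` and regular on `∂W'`, `f < 1` inside) and a level
`a < 1` such that

* `a` is a regular value of `f` (no critical point lies on the level `f = a`; this is Milnor's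
  hypothesis in Thm. 3.2),
* `ι` identifies `W` with the sublevel set `f⁻¹ (-∞, a]`,
* `f` has exactly one critical point above level `a`, and it has index `k`.

Since `f = 1` on `∂W'` and `a < 1`, the sublevel set `f⁻¹ (-∞, a] = range ι` lies in the
interior of `W'`.  Up to diffeomorphism relative to `W` this is the classical handle attachment
with corners straightened.  Milnor, *Morse theory* (1963), Thm. 3.2 ("passing a nondegenerate
critical point of index `k` attaches a `k`-handle"); Milnor (1965), Thm. 3.13; Kosinski,
*Differential Manifolds* (1993), VI.6–7.

The parameters `n k W W'` are explicit binders of the definition (a predicate on the pair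
`(W, W')`, not a closed statement). [cite: Kosinski1993, VI.6] -/
def IsHandleAttachment (n k : ℕ) (W W' : Type u) [TopologicalSpace W]
    [ChartedSpace (EuclideanHalfSpace (n + 1)) W] [TopologicalSpace W']
    [ChartedSpace (EuclideanHalfSpace (n + 1)) W'] : Prop :=
  ∃ (ι : W → W') (f : W' → ℝ) (a : ℝ),
    Manifold.IsSmoothEmbedding (𝓡∂ (n + 1)) (𝓡∂ (n + 1)) ∞ ι ∧ IsMorseAdapted (𝓡∂ (n + 1)) f ∧
    a < 1 ∧ (∀ z, IsMCriticalPt (𝓡∂ (n + 1)) f z → f z ≠ a) ∧ range ι = f ⁻¹' Iic a ∧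
    (∃! z, IsMCriticalPt (𝓡∂ (n + 1)) f z ∧ a < f z) ∧
    ∀ z, IsMCriticalPt (𝓡∂ (n + 1)) f z → a < f z → morseIndex (𝓡∂ (n + 1)) f z = k

/-- `W` is a *handlebody with handles of index at most `k`* (built on `∅`): `W` carries a Morse
function adapted to `∂W` all of whose critical points have index `≤ k`.  By Milnor (1963),
Thms. 3.1–3.2, such a (compact) `W` is diffeomorphic to `Dⁿ⁺¹ ∪ handles of index ≤ k`; the
equivalence "handle presentation with handles of index `≤ k` ⟺ Morse function with critical
points of index `≤ k`" is Kosinski, *Differential Manifolds* (1993), VII, Thm. 1.1, Cor. 1.2 and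
§2 (Props. 2.1–2.2 and the converse "to every presentation there corresponds a Morse function
that yields it"); see also Milnor, *Lectures on the h-cobordism theorem* (1965), §3
(Thms. 3.12–3.13), Matsumoto, *An introduction to Morse theory* (2001), Def. 3.3 and Thm. 3.4,
Gompf–Stipsicz, *4-manifolds and Kirby calculus* (1999), §4.2.  Compactness of `W` is NOT part
of the predicate (consumers assume `[CompactSpace W]` where needed); the closed ball `𝔻ⁿ⁺¹` is
a handlebody of index `≤ 0` (`ClosedBallHandles.lean`).

The parameters `n k W` are explicit binders of the definition: this is a predicate on `W`
("`W` is a `k`-handlebody"), used as a hypothesis `(h : IsHandlebodyOfIndexLE n k W)`, not a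
closed statement to be discharged. [cite: Kosinski1993, VII.1.2] -/
def IsHandlebodyOfIndexLE (n k : ℕ) (W : Type u) [TopologicalSpace W]
    [ChartedSpace (EuclideanHalfSpace (n + 1)) W] : Prop :=
  ∃ f : W → ℝ, IsMorseAdapted (𝓡∂ (n + 1)) f ∧
    ∀ z, IsMCriticalPt (𝓡∂ (n + 1)) f z → morseIndex (𝓡∂ (n + 1)) f z ≤ k

/-- `W` *has a handle decomposition with `c k` handles of index `k`* (for every `k`): `W` carries a
Morse function adapted to `∂W` with exactly `c k` critical points of index `k`.  The count uses
`Set.ncard`; for compact `W` the critical set is finite (`IsMorse.finite_criticalSet`), so no junk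
value `0` occurs.  Milnor, *Morse theory* (1963), Thms. 3.2 and 3.5; Milnor (1965), §3;
Kosinski (1993), VII, Thm. 1.1 and §2.  The parameters `n W c` are explicit binders (a predicate
on `W`). [cite: Kosinski1993, VII.1.1] -/
def HasHandleDecomposition (n : ℕ) (W : Type u) [TopologicalSpace W]
    [ChartedSpace (EuclideanHalfSpace (n + 1)) W] (c : ℕ → ℕ) : Prop :=
  ∃ f : W → ℝ, IsMorseAdapted (𝓡∂ (n + 1)) f ∧
    ∀ k, (criticalSetOfIndex (𝓡∂ (n + 1)) f k).ncard = c k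

variable {n k : ℕ} {W W' : Type u} [TopologicalSpace W] [ChartedSpace (EuclideanHalfSpace (n + 1)) W]
  [TopologicalSpace W'] [ChartedSpace (EuclideanHalfSpace (n + 1)) W']

/-- The submanifold `W` of a handle attachment `W ∪ hᵏ` lies in the interior of `W'`: `f = 1` on
`∂W'` while `f ≤ a < 1` on `range ι` (Milnor 1963, §3). [cite: Milnor1963, §3] -/
theorem IsHandleAttachment.exists_range_subset_interior (h : IsHandleAttachment n k W W') :
    ∃ ι : W → W', Manifold.IsSmoothEmbedding (𝓡∂ (n + 1)) (𝓡∂ (n + 1)) ∞ ι ∧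
      range ι ⊆ (𝓡∂ (n + 1)).interior W' := by
  obtain ⟨ι, f, a, hι, hf, ha, -, hrange, -⟩ := h
  refine ⟨ι, hι, fun z hz => ?_⟩
  by_contra hz'
  have hb : z ∈ (𝓡∂ (n + 1)).boundary W' := by
    rw [← ModelWithCorners.compl_interior]; exact hz'
  have h1 : f z = 1 := (hf.2.1 z hb).1
  rw [hrange] at hz
  exact absurd (h1 ▸ hz : (1 : ℝ) ≤ a) (not_le.mpr ha)

/-- The index of an attached handle is at most `n + 1 = dim W'` (`morseIndex_le_finrank`;
Milnor 1963, §3). [cite: Milnor1963, §3] -/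
theorem IsHandleAttachment.le (h : IsHandleAttachment n k W W') : k ≤ n + 1 := by
  obtain ⟨ι, f, a, -, -, -, -, -, ⟨z, ⟨hz, hza⟩, -⟩, hk⟩ := h
  rw [← hk z hz hza]
  simpa using morseIndex_le_finrank (𝓡∂ (n + 1)) f z

/-- A handlebody with handles of index `≤ k` is a handlebody with handles of index `≤ l` for
`k ≤ l` (Milnor 1965, §3). [cite: MilnorHCobordism1965, §3] -/
theorem IsHandlebodyOfIndexLE.mono {k l : ℕ} (hkl : k ≤ l) (h : IsHandlebodyOfIndexLE n k W) :
    IsHandlebodyOfIndexLE n l W :=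
  h.imp fun _ hf => ⟨hf.1, fun z hz => (hf.2 z hz).trans hkl⟩

/-- The empty manifold is a handlebody with no handles (Milnor 1965, §3: the handlebody built on
`∅` with zero handles). [cite: MilnorHCobordism1965, §3] -/
theorem isHandlebodyOfIndexLE_of_isEmpty [IsEmpty W] : IsHandlebodyOfIndexLE n k W :=
  ⟨fun _ => 0, ⟨⟨fun z => isEmptyElim z, fun z => isEmptyElim z⟩, fun z => isEmptyElim z,
    fun z => isEmptyElim z⟩, fun z => isEmptyElim z⟩

/-- The empty manifold has the empty handle decomposition (Milnor 1965, §3). [cite: MilnorHCobordism1965, §3] -/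
theorem hasHandleDecomposition_zero_of_isEmpty [IsEmpty W] : HasHandleDecomposition n W 0 :=
  ⟨fun _ => 0, ⟨⟨fun z => isEmptyElim z, fun z => isEmptyElim z⟩, fun z => isEmptyElim z,
    fun z => isEmptyElim z⟩, fun k => by
      rw [Pi.zero_apply, Set.ncard_eq_zero]; exact Set.eq_empty_of_isEmpty _⟩

/-- A compact manifold with a handle decomposition without handles of index `> k` is a handlebody
with handles of index `≤ k` (Milnor 1965, §3).  Uses finiteness of the critical set of a Morse
function on a compact manifold (`IsMorse.finite_criticalSet`) to read `ncard = 0` as emptiness.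
Named fact, discharged in `HandlesProofs.lean`
(`HasHandleDecomposition.isHandlebodyOfIndexLE_holds`). [cite: MilnorHCobordism1965, §3] -/
def HasHandleDecomposition.isHandlebodyOfIndexLE : Prop :=
  ∀ [IsManifold (𝓡∂ (n + 1)) ∞ W] [CompactSpace W] {c : ℕ → ℕ} (h : HasHandleDecomposition n W c) (hc : ∀ j, k < j → c j = 0),
    IsHandlebodyOfIndexLE n k W

/- interim proof relied on results that are now named facts (D-0014); demoted to a fact by the M5 import, proof preserved:
:= by
  obtain ⟨f, hf, hcount⟩ := h
  refine ⟨f, hf, fun z hz => ?_⟩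
  by_contra hlt
  rw [not_le] at hlt
  have hfin : (criticalSetOfIndex (𝓡∂ (n + 1)) f (morseIndex (𝓡∂ (n + 1)) f z)).Finite :=
    hf.isMorse.finite_criticalSet.subset (criticalSetOfIndex_subset _ f _)
  have hempty : criticalSetOfIndex (𝓡∂ (n + 1)) f (morseIndex (𝓡∂ (n + 1)) f z) = ∅ := by
    rw [← Set.ncard_eq_zero hfin, hcount, hc _ hlt]
  have hzmem : z ∈ criticalSetOfIndex (𝓡∂ (n + 1)) f (morseIndex (𝓡∂ (n + 1)) f z) := ⟨hz, rfl⟩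
  rw [hempty] at hzmem
  exact hzmem
-/

/-- A compact manifold with boundary carrying a Morse function adapted to its boundary has a
handle decomposition, with `c k` the number of critical points of index `k` (Milnor 1963,
Thms. 3.2, 3.5; tautological for the Morse-theoretic definition). [cite: Milnor1963, Thms. 3.2  3.5] -/
theorem hasHandleDecomposition_of_isMorseAdapted {f : W → ℝ} (hf : IsMorseAdapted (𝓡∂ (n + 1)) f) :
    HasHandleDecomposition n W fun k => (criticalSetOfIndex (𝓡∂ (n + 1)) f k).ncard :=
  ⟨f, hf, fun _ => rfl⟩

/-- Every compact smooth manifold with boundary admits a handle decomposition (existence of a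
Morse function adapted to the boundary; Milnor 1965, Thm. 2.5; Milnor 1963, §3; Smale 1962).
Named fact: existence of Morse functions is absent from Mathlib. [cite: MilnorHCobordism1965, Thm. 2.5] -/
def exists_hasHandleDecomposition : Prop :=
  ∀ [T2Space W] [SecondCountableTopology W] [IsManifold (𝓡∂ (n + 1)) ∞ W] [CompactSpace W],
    ∃ c, HasHandleDecomposition n W c

end Handles

end Literature.Topology.FourManifolds
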